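import Summits.HodgeConjecture.CorCM.Census.SexticOcticWeilParts
import Summits.HodgeConjecture.CorCM.DecicWeil23MultiFrameTransfer
import HarnessLib

/-!
# COR-CM — `E × T × B` over a sextic and an octic CM field sharing `k`: the slots `(k, K₁, K₂)`, the model map, the REALISED PAIRS
# of permutations, FRAME TRANSFER (no Galois hypothesis), joint transitivity from the frames, and the divisor lines of conjugate pairs

Cell `pub-hodgecm2` (COR-CM), seat b30 gen 26 (2026-08-23); count-neutral own lane SEXTIC-OCTIC, over the kernel census
`Census/SexticOcticWeil{,Defect,Parts,PartsBalanced,Extraction}`.  Theorems, plus THREE bookkeeping definitions (the slot map `soSlots`,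
the model map `toPtS`, the finset `realisedPairs` of pairs of permutations of the conjugate pairs of `K₁` and of `K₂` induced by ONE
automorphism of `ℂ`); no named fact, no `sorry`.
SETTING: index type `I`, fields `Kf`, three slots `soSlots i₀ i₁ i₂ = (i₀, i₁, i₂)` (`Fin.cons`); realisations
`A j ⊨ (Kf (soSlots i₀ i₁ i₂ j); Φ j)`: `E = A 0 ⊨ (k; {τ})` (`hΨ`), `T = A 1 ⊨ (K₁; Φ 1)` with `s ∈ Φ 1 ⟺ (e₁ s).2 = [(e₁ s).1 = 0]`
(`hΦ₁`) for a frame `e₁ : Hom(K₁,ℂ) ≃ Fin 3 × Bool`, `B = A 2 ⊨ (K₂; Φ 2)` alike for `e₂ : Hom(K₂,ℂ) ≃ Fin 4 × Bool` (`hΦ₂`).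

* §0 `soSlots`, `toPtS`, `sigma_cases₃`; §1 frames of any size: `exists_perm_of_comp_tau_eq_fin` (an automorphism fixing `τ` permutes the
  `τ`-fibre), `apply_comp_eq_of_realises_fin` (`e (ρ ∘ s) = (π (e s).1, (e s).2)`), `comp_tau_eq_of_realises_fin`;
* §2 `realisedPairs e₁ e₂`, **`jointTransitive_realisedPairs`** (from the intrinsic `hjt`); §3 `toPtS_injective`, `toPtS_conj_smul`,
  `comp_mem_iff_toPtS_mem_phiS`, **`modelBalancedS_of_isGaloisBalancedAlg`** — FRAME TRANSFER for every slot map `κ : Fin N → Fin 3`, NO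
  Galois hypothesis; §4 `weightClassesAlg_le_algebraicClasses_of_isPairPartS` (pair parts have divisor lines).
HONEST FRAMING: nothing about the Hodge conjecture is concluded here; `HC_CM` is not asserted.
[cite: Pohlmann1968, Thm 1] [cite: GaoUllmo2025, Thm 3.1 (3.2)] [cite: Shimura1998, §18.2 Lemma (i)] [cite: Gordon1999HodgeAVSurvey, 9.2.2]

## References
* [Pohlmann1968] Ann. of Math. 88 (1968), Thm 1.  [GaoUllmo2025] J. Inst. Math. Jussieu 25 (2025), Thm 3.1 (3.2).  [Shimura1998]
  G. Shimura, *Abelian varieties with CM and modular functions*, §18.2 Lemma (i).  [Gordon1999HodgeAVSurvey] CRM Monogr. 10 (1999), 9.2.2.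
-/

noncomputable section

open CategoryTheory CategoryTheory.Limits NumberField

namespace Summit.HodgeConjecture.CorCM.SexticOcticWeil

open Literature.AlgebraicGeometry Literature.AlgebraicGeometry.Motives Literature.AlgebraicGeometry.HodgeTheory
open Literature.AlgebraicGeometry.ComplexMultiplication (IsCMTypeRealisation)
open Literature.AlgebraicGeometry.Pohlmann1968
open Literature.AlgebraicTopology.SingularHomology
open Literature.NumberTheory.ComplexMultiplication
open Summit.HodgeConjecture.CorCM.Census.SexticOcticWeil (PtS cjS cjS_inl cjS_inr_inl cjS_inr_inr cjS_cjS cjS_ne phiS inl_mem_phiS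
  inr_inl_mem_phiS inr_inr_mem_phiS ModelBalancedS IsPairPartS JointTransitive)
open Summit.HodgeConjecture.CorCM.OcticCurveFourfold (comp_injective comp_conjugate)
open Summit.HodgeConjecture.CorCM.CMWeights (weightClassesAlg_comp_le_algebraicClasses_of_injOn)
open Summit.HodgeConjecture.CorCM.PairWeights
open Summit.HodgeConjecture.CorCM.DihedralSexticPairCurvePowers (ncard_sep_eq_card_filter)

open scoped Classical Pointwise

/-! ## §0 The slots and the model map -/
section Defs

variable {I : Type}

/-- The fields of the three slots of `E × T × B`: `(i₀, i₁, i₂)` — `Fin.cons`, so that the three values are DEFINITIONALLY `i₀`, `i₁`,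
`i₂` at `0, 1, 2`. [folklore] -/
def soSlots (i₀ i₁ i₂ : I) : Fin 3 → I := Fin.cons i₀ (Fin.cons i₁ fun _ : Fin 1 => i₂)

variable {Kf : I → Type} [∀ i, Field (Kf i)] {i₀ i₁ i₂ : I}

/-- **The model map** `Hom(k × K₁ × K₂, ℂ) → PtS`: `(0, σ) ↦ inl [σ = τ]`, `(1, s) ↦ inr (inl (e₁ s))`, `(2, t) ↦ inr (inr (e₂ t))`.
[folklore] -/
def toPtS (e₁ : (Kf i₁ →+* ℂ) ≃ Fin 3 × Bool) (e₂ : (Kf i₂ →+* ℂ) ≃ Fin 4 × Bool) (τ : Kf i₀ →+* ℂ) :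
    ((j : Fin 3) × (Kf (soSlots i₀ i₁ i₂ j) →+* ℂ)) → PtS := fun x =>
  Fin.cases (motive := fun j => (Kf (soSlots i₀ i₁ i₂ j) →+* ℂ) → PtS)
    (fun σ => Sum.inl (decide (σ = τ)))
    (fun j' => Fin.cases (motive := fun j' : Fin 2 => (Kf (soSlots i₀ i₁ i₂ j'.succ) →+* ℂ) → PtS)
      (fun s => Sum.inr (Sum.inl (e₁ s))) (fun _ t => Sum.inr (Sum.inr (e₂ t))) j') x.1 x.2

variable (e₁ : (Kf i₁ →+* ℂ) ≃ Fin 3 × Bool) (e₂ : (Kf i₂ →+* ℂ) ≃ Fin 4 × Bool) (τ : Kf i₀ →+* ℂ)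

/-- `toPtS` on the curve slot. [folklore] -/
@[simp] theorem toPtS_zero (σ : Kf i₀ →+* ℂ) : toPtS e₁ e₂ τ ⟨0, σ⟩ = Sum.inl (decide (σ = τ)) := rfl
/-- `toPtS` on the threefold slot. [folklore] -/
@[simp] theorem toPtS_one (s : Kf i₁ →+* ℂ) : toPtS e₁ e₂ τ ⟨1, s⟩ = Sum.inr (Sum.inl (e₁ s)) := rfl
/-- `toPtS` on the fourfold slot. [folklore] -/
@[simp] theorem toPtS_two (t : Kf i₂ →+* ℂ) : toPtS e₁ e₂ τ ⟨2, t⟩ = Sum.inr (Sum.inr (e₂ t)) := rfl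

/-- Every point of the index set is `(0, σ)`, `(1, s)` or `(2, t)`. [folklore] -/
theorem sigma_cases₃ (x : (j : Fin 3) × (Kf (soSlots i₀ i₁ i₂ j) →+* ℂ)) :
    (∃ σ : Kf i₀ →+* ℂ, x = ⟨0, σ⟩) ∨ (∃ s : Kf i₁ →+* ℂ, x = ⟨1, s⟩) ∨ ∃ t : Kf i₂ →+* ℂ, x = ⟨2, t⟩ := by
  obtain ⟨j, s⟩ := x
  refine Fin.cases ?_ (fun j' => ?_) j s
  · exact fun σ => Or.inl ⟨σ, rfl⟩
  · refine Fin.cases ?_ (fun j'' => ?_) j'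
    · exact fun s => Or.inr (Or.inl ⟨s, rfl⟩)
    · intro t
      obtain rfl : j'' = 0 := Subsingleton.elim _ _
      exact Or.inr (Or.inr ⟨t, rfl⟩)

/-- Complex conjugation on the curve slot of the index set. [folklore] -/
theorem conj_smul_zero₃ (σ : Kf i₀ →+* ℂ) :
    (starRingAut : ℂ ≃+* ℂ) • (⟨0, σ⟩ : (j : Fin 3) × (Kf (soSlots i₀ i₁ i₂ j) →+* ℂ)) =
      ⟨0, (ComplexEmbedding.conjugate σ : Kf i₀ →+* ℂ)⟩ :=
  Sigma.ext rfl (heq_of_eq (RingHom.ext fun _ => rfl))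
/-- Complex conjugation on the threefold slot of the index set. [folklore] -/
theorem conj_smul_one₃ (s : Kf i₁ →+* ℂ) :
    (starRingAut : ℂ ≃+* ℂ) • (⟨1, s⟩ : (j : Fin 3) × (Kf (soSlots i₀ i₁ i₂ j) →+* ℂ)) =
      ⟨1, (ComplexEmbedding.conjugate s : Kf i₁ →+* ℂ)⟩ :=
  Sigma.ext rfl (heq_of_eq (RingHom.ext fun _ => rfl))
/-- Complex conjugation on the fourfold slot of the index set. [folklore] -/
theorem conj_smul_two₃ (t : Kf i₂ →+* ℂ) :
    (starRingAut : ℂ ≃+* ℂ) • (⟨2, t⟩ : (j : Fin 3) × (Kf (soSlots i₀ i₁ i₂ j) →+* ℂ)) =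
      ⟨2, (ComplexEmbedding.conjugate t : Kf i₂ →+* ℂ)⟩ :=
  Sigma.ext rfl (heq_of_eq (RingHom.ext fun _ => rfl))

end Defs

/-! ## §1 Frames of any size: an automorphism fixing `τ` permutes the `τ`-fibre -/

section Frames

variable {F k : Type} [Field F] [Field k] {n : ℕ} {e : (F →+* ℂ) ≃ Fin n × Bool} {τ : k →+* ℂ} {i : k →+* F}
  (he_sign : ∀ s : F →+* ℂ, (e s).2 = true ↔ s.comp i = τ)
  (he_conj : ∀ s : F →+* ℂ, e (ComplexEmbedding.conjugate s) = ((e s).1, !(e s).2))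

include he_sign in
/-- **An automorphism of `ℂ` fixing `τ` permutes the embeddings over `τ`**: `ρ ∘ e⁻¹(a, true) = e⁻¹(π a, true)` for a permutation `π`
of `Fin n` (injective self-map of a finite set; the size-free form of gen 20's `OcticWeilOrbit.exists_perm_of_comp_tau_eq`).
[cite: Shimura1998, §18.2 Lemma (i)] -/
theorem exists_perm_of_comp_tau_eq_fin (ρ : ℂ ≃+* ℂ) (hρ : (ρ : ℂ →+* ℂ).comp τ = τ) :
    ∃ π : Equiv.Perm (Fin n), ∀ a : Fin n, (ρ : ℂ →+* ℂ).comp (e.symm (a, true)) = e.symm (π a, true) := by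
  have hover : ∀ a : Fin n, (e ((ρ : ℂ →+* ℂ).comp (e.symm (a, true)))).2 = true := fun a => by
    rw [he_sign, RingHom.comp_assoc, (he_sign _).1 (by rw [Equiv.apply_symm_apply]), hρ]
  let f : Fin n → Fin n := fun a => (e ((ρ : ℂ →+* ℂ).comp (e.symm (a, true)))).1
  have hf : ∀ a : Fin n, (ρ : ℂ →+* ℂ).comp (e.symm (a, true)) = e.symm (f a, true) := fun a => by
    apply e.injective
    rw [Equiv.apply_symm_apply]
    exact Prod.ext rfl (hover a)
  have hfinj : Function.Injective f := fun a b hab => by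
    have h : (ρ : ℂ →+* ℂ).comp (e.symm (a, true)) = (ρ : ℂ →+* ℂ).comp (e.symm (b, true)) := by rw [hf a, hf b, hab]
    have h' := e.symm.injective (comp_injective (K := F) ρ h)
    exact (Prod.mk.inj h').1
  exact ⟨Equiv.ofBijective f (Finite.injective_iff_bijective.1 hfinj), fun a => hf a⟩

include he_conj in
/-- **A realiser of the permutation `π` acts on the frame by `e (ρ ∘ s) = (π (e s).1, (e s).2)`** (it commutes with complex
conjugation on the embeddings of the CM field `F`). [cite: Shimura1998, §18.2 Lemma (i)] -/
theorem apply_comp_eq_of_realises_fin [NumberField F] [IsCMField F] (ρ : ℂ ≃+* ℂ) {π : Equiv.Perm (Fin n)}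
    (hρ : ∀ a : Fin n, (ρ : ℂ →+* ℂ).comp (e.symm (a, true)) = e.symm (π a, true)) (s : F →+* ℂ) :
    e ((ρ : ℂ →+* ℂ).comp s) = (π (e s).1, (e s).2) := by
  cases h2 : (e s).2
  · have hs : s = ComplexEmbedding.conjugate (e.symm ((e s).1, true)) := by
      apply e.injective
      rw [he_conj, Equiv.apply_symm_apply]
      exact Prod.ext rfl (by rw [h2]; rfl)
    rw [hs, comp_conjugate ρ, he_conj, hρ, Equiv.apply_symm_apply, ← hs]
    rfl
  · have hs : s = e.symm ((e s).1, true) := by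
      apply e.injective
      rw [Equiv.apply_symm_apply]
      exact Prod.ext rfl h2
    rw [hs, hρ, Equiv.apply_symm_apply, ← hs]

include he_sign in
/-- **A realiser of `π` fixes `τ`** (for `n ≠ 0`). [cite: Shimura1998, §18.2 Lemma (i)] -/
theorem comp_tau_eq_of_realises_fin [NeZero n] (ρ : ℂ ≃+* ℂ) {π : Equiv.Perm (Fin n)}
    (hρ : ∀ a : Fin n, (ρ : ℂ →+* ℂ).comp (e.symm (a, true)) = e.symm (π a, true)) : (ρ : ℂ →+* ℂ).comp τ = τ := by
  have h0 : (e.symm ((0 : Fin n), true)).comp i = τ := (he_sign _).1 (by rw [Equiv.apply_symm_apply])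
  have h1 : (e.symm (π 0, true)).comp i = τ := (he_sign _).1 (by rw [Equiv.apply_symm_apply])
  calc (ρ : ℂ →+* ℂ).comp τ = ((ρ : ℂ →+* ℂ).comp (e.symm (0, true))).comp i := by rw [RingHom.comp_assoc, h0]
    _ = τ := by rw [hρ, h1]

end Frames

/-! ## §2 The realised pairs of permutations; joint transitivity; membership read in the frames -/

section Realised

variable {F₁ F₂ k : Type} [Field F₁] [Field F₂] [Field k]

/-- **The realised pairs**: the pairs `(π₁, π₂)` of permutations of the three conjugate pairs of `K₁` and the four of `K₂` induced by
ONE automorphism `ρ` of `ℂ` (`ρ ∘ e₁⁻¹(a, true) = e₁⁻¹(π₁ a, true)` and `ρ ∘ e₂⁻¹(b, true) = e₂⁻¹(π₂ b, true)`).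
[cite: Shimura1998, §18.2 Lemma (i)] -/
def realisedPairs (e₁ : (F₁ →+* ℂ) ≃ Fin 3 × Bool) (e₂ : (F₂ →+* ℂ) ≃ Fin 4 × Bool) :
    Finset (Equiv.Perm (Fin 3) × Equiv.Perm (Fin 4)) :=
  Finset.univ.filter fun π => ∃ ρ : ℂ ≃+* ℂ,
    (∀ a : Fin 3, (ρ : ℂ →+* ℂ).comp (e₁.symm (a, true)) = e₁.symm (π.1 a, true)) ∧
      ∀ b : Fin 4, (ρ : ℂ →+* ℂ).comp (e₂.symm (b, true)) = e₂.symm (π.2 b, true)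

variable (e₁ : (F₁ →+* ℂ) ≃ Fin 3 × Bool) (e₂ : (F₂ →+* ℂ) ≃ Fin 4 × Bool)

/-- Membership in `realisedPairs e₁ e₂`. [folklore] -/
theorem mem_realisedPairs (π : Equiv.Perm (Fin 3) × Equiv.Perm (Fin 4)) :
    π ∈ realisedPairs e₁ e₂ ↔ ∃ ρ : ℂ ≃+* ℂ,
      (∀ a : Fin 3, (ρ : ℂ →+* ℂ).comp (e₁.symm (a, true)) = e₁.symm (π.1 a, true)) ∧
        ∀ b : Fin 4, (ρ : ℂ →+* ℂ).comp (e₂.symm (b, true)) = e₂.symm (π.2 b, true) := by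
  simp [realisedPairs]

variable {e₁ e₂} {τ : k →+* ℂ} {i₁ : k →+* F₁} {i₂ : k →+* F₂}
  (he₁_sign : ∀ s : F₁ →+* ℂ, (e₁ s).2 = true ↔ s.comp i₁ = τ)
  (he₂_sign : ∀ t : F₂ →+* ℂ, (e₂ t).2 = true ↔ t.comp i₂ = τ)

include he₁_sign he₂_sign in
/-- **An automorphism of `ℂ` moving `(e₁⁻¹(x,+), e₂⁻¹(y,+))` to the base pair `(e₁⁻¹(0,+), e₂⁻¹(0,+))` yields a realised pair with
`π₁ x = 0`, `π₂ y = 0`** (it fixes `τ`, hence permutes both `τ`-fibres). [cite: Shimura1998, §18.2 Lemma (i)] -/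
theorem exists_mem_realisedPairs_of_moves {x : Fin 3} {y : Fin 4} {ρ : ℂ ≃+* ℂ}
    (hx : (ρ : ℂ →+* ℂ).comp (e₁.symm (x, true)) = e₁.symm (0, true))
    (hy : (ρ : ℂ →+* ℂ).comp (e₂.symm (y, true)) = e₂.symm (0, true)) :
    ∃ π ∈ realisedPairs e₁ e₂, π.1 x = 0 ∧ π.2 y = 0 := by
  have hρτ : (ρ : ℂ →+* ℂ).comp τ = τ := by
    have hx' : (e₁.symm (x, true)).comp i₁ = τ := (he₁_sign _).1 (by rw [Equiv.apply_symm_apply])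
    have h0 : (e₁.symm ((0 : Fin 3), true)).comp i₁ = τ := (he₁_sign _).1 (by rw [Equiv.apply_symm_apply])
    calc (ρ : ℂ →+* ℂ).comp τ = ((ρ : ℂ →+* ℂ).comp (e₁.symm (x, true))).comp i₁ := by rw [RingHom.comp_assoc, hx']
      _ = τ := by rw [hx, h0]
  obtain ⟨π₁, hπ₁⟩ := exists_perm_of_comp_tau_eq_fin he₁_sign ρ hρτ
  obtain ⟨π₂, hπ₂⟩ := exists_perm_of_comp_tau_eq_fin he₂_sign ρ hρτ
  refine ⟨(π₁, π₂), (mem_realisedPairs e₁ e₂ _).2 ⟨ρ, hπ₁, hπ₂⟩, ?_, ?_⟩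
  · exact (Prod.mk.inj (e₁.symm.injective ((hπ₁ x).symm.trans hx))).1
  · exact (Prod.mk.inj (e₂.symm.injective ((hπ₂ y).symm.trans hy))).1

include he₁_sign he₂_sign in
/-- **JOINT TRANSITIVITY of the realised pairs from the frames**: if every pair of embeddings over `τ` is moved to the base pair by an
automorphism of `ℂ` (`hjt` — downstream automatic for a sextic and an octic field through `k`), then `realisedPairs e₁ e₂` is jointly
transitive on `Fin 3 × Fin 4`. [cite: DixonMortimer1996, §2.1] -/
theorem jointTransitive_realisedPairs
    (hjt : ∀ (x : Fin 3) (y : Fin 4), ∃ ρ : ℂ ≃+* ℂ,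
      (ρ : ℂ →+* ℂ).comp (e₁.symm (x, true)) = e₁.symm (0, true) ∧ (ρ : ℂ →+* ℂ).comp (e₂.symm (y, true)) = e₂.symm (0, true)) :
    JointTransitive (realisedPairs e₁ e₂) := by
  intro x y
  obtain ⟨ρ, hx, hy⟩ := hjt x y
  exact exists_mem_realisedPairs_of_moves he₁_sign he₂_sign hx hy

end Realised

/-! ## §3 Frame transfer for the products of copies, no Galois hypothesis -/

section Transfer

variable {I : Type} {Kf : I → Type} [∀ i, Field (Kf i)] {i₀ i₁ i₂ : I}
  {e₁ : (Kf i₁ →+* ℂ) ≃ Fin 3 × Bool} {e₂ : (Kf i₂ →+* ℂ) ≃ Fin 4 × Bool} {τ : Kf i₀ →+* ℂ}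
  (hττ : ComplexEmbedding.conjugate τ ≠ τ) (hk : ∀ σ : Kf i₀ →+* ℂ, σ = τ ∨ σ = ComplexEmbedding.conjugate τ)

include hττ hk in
/-- The model map is injective (`Hom(k, ℂ) = {τ, τ̄}`, `e₁`, `e₂` bijections, the slot is recorded). [folklore] -/
theorem toPtS_injective : Function.Injective (toPtS (i₀ := i₀) e₁ e₂ τ) := by
  intro x y hxy
  rcases sigma_cases₃ x with ⟨σ, rfl⟩ | ⟨s, rfl⟩ | ⟨t, rfl⟩ <;>
    rcases sigma_cases₃ y with ⟨σ', rfl⟩ | ⟨s', rfl⟩ | ⟨t', rfl⟩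
  · rw [toPtS_zero, toPtS_zero, Sum.inl.injEq] at hxy
    rcases hk σ with rfl | rfl <;> rcases hk σ' with rfl | rfl
    · rfl
    · simp only [decide_true] at hxy; exact absurd (of_decide_eq_true hxy.symm) hττ
    · simp only [decide_true] at hxy; exact absurd (of_decide_eq_true hxy) hττ
    · rfl
  · exact absurd hxy (by rw [toPtS_zero, toPtS_one]; exact Sum.inl_ne_inr)
  · exact absurd hxy (by rw [toPtS_zero, toPtS_two]; exact Sum.inl_ne_inr)
  · exact absurd hxy (by rw [toPtS_zero, toPtS_one]; exact Sum.inr_ne_inl)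
  · rw [toPtS_one, toPtS_one, Sum.inr.injEq, Sum.inl.injEq] at hxy
    rw [e₁.injective hxy]
  · exact absurd hxy (by rw [toPtS_one, toPtS_two, Sum.inr.injEq]; exact Sum.inl_ne_inr)
  · exact absurd hxy (by rw [toPtS_zero, toPtS_two]; exact Sum.inr_ne_inl)
  · exact absurd hxy (by rw [toPtS_one, toPtS_two, Sum.inr.injEq]; exact Sum.inr_ne_inl)
  · rw [toPtS_two, toPtS_two, Sum.inr.injEq, Sum.inr.injEq] at hxy
    rw [e₂.injective hxy]

variable {i₁' : Kf i₀ →+* Kf i₁} {i₂' : Kf i₀ →+* Kf i₂}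
  (he₁_sign : ∀ s : Kf i₁ →+* ℂ, (e₁ s).2 = true ↔ s.comp i₁' = τ)
  (he₂_sign : ∀ t : Kf i₂ →+* ℂ, (e₂ t).2 = true ↔ t.comp i₂' = τ)
  (he₁_conj : ∀ s : Kf i₁ →+* ℂ, e₁ (ComplexEmbedding.conjugate s) = ((e₁ s).1, !(e₁ s).2))
  (he₂_conj : ∀ t : Kf i₂ →+* ℂ, e₂ (ComplexEmbedding.conjugate t) = ((e₂ t).1, !(e₂ t).2))

include he₁_conj he₂_conj hττ hk in
/-- Conjugation is read in the model: `toPtS x̄ = cjS (toPtS x)`. [folklore] -/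
theorem toPtS_conj_smul (x : (j : Fin 3) × (Kf (soSlots i₀ i₁ i₂ j) →+* ℂ)) :
    toPtS e₁ e₂ τ ((starRingAut : ℂ ≃+* ℂ) • x) = cjS (toPtS e₁ e₂ τ x) := by
  rcases sigma_cases₃ x with ⟨σ, rfl⟩ | ⟨s, rfl⟩ | ⟨t, rfl⟩
  · have key : decide (ComplexEmbedding.conjugate σ = τ) = !decide (σ = τ) := by
      rcases hk σ with rfl | rfl
      · rw [decide_eq_false hττ]; simp
      · rw [ComplexEmbedding.involutive_conjugate, decide_eq_false hττ]; simp
    rw [conj_smul_zero₃, toPtS_zero, toPtS_zero, key, cjS_inl]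
  · rw [conj_smul_one₃, toPtS_one, toPtS_one, he₁_conj, cjS_inr_inl]
  · rw [conj_smul_two₃, toPtS_two, toPtS_two, he₂_conj, cjS_inr_inr]

include hττ hk he₁_sign in
/-- On `Hom(k, ℂ) = {τ, τ̄}`, a realiser of a pair fixes `τ`: `ρ ∘ σ = τ ⟺ σ = τ`. [folklore] -/
theorem comp_eq_tau_iff_of_realises₃ (ρ : ℂ ≃+* ℂ) {π₁ : Equiv.Perm (Fin 3)}
    (hρ : ∀ a : Fin 3, (ρ : ℂ →+* ℂ).comp (e₁.symm (a, true)) = e₁.symm (π₁ a, true)) (σ : Kf i₀ →+* ℂ) :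
    (ρ : ℂ →+* ℂ).comp σ = τ ↔ σ = τ := by
  have hρτ := comp_tau_eq_of_realises_fin he₁_sign ρ hρ
  rcases hk σ with rfl | rfl
  · exact ⟨fun _ => rfl, fun _ => hρτ⟩
  · constructor
    · intro h
      exact absurd (comp_injective (K := Kf i₀) ρ (h.trans hρτ.symm)) hττ
    · intro h
      exact absurd h hττ

variable {Φ : ∀ j : Fin 3, CMType (Kf (soSlots i₀ i₁ i₂ j))}
  (hΨ : ∀ σ : Kf i₀ →+* ℂ, σ ∈ (Φ 0).1 ↔ σ = τ)
  (hΦ₁ : ∀ s : Kf i₁ →+* ℂ, s ∈ (Φ 1).1 ↔ (e₁ s).2 = decide ((e₁ s).1 = 0))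
  (hΦ₂ : ∀ t : Kf i₂ →+* ℂ, t ∈ (Φ 2).1 ↔ (e₂ t).2 = decide ((e₂ t).1 = 0))

include hττ hk he₁_sign he₁_conj he₂_conj hΨ hΦ₁ hΦ₂ in
/-- **Membership read in the frames**: for a realiser `ρ` of the pair `π`, `ρ ∘ x ∈ Φ ⟺ toPtS x ∈ phiS π` (on the curve slot `ρ`
fixes `τ`; on the other slots `ρ` keeps signs and moves the pair `a` to `π.1 a`, resp. `π.2 a`).
[cite: GaoUllmo2025, Thm 3.1 (3.2)] [cite: Shimura1998, §18.2 Lemma (i)] -/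
theorem comp_mem_iff_toPtS_mem_phiS [NumberField (Kf i₁)] [IsCMField (Kf i₁)] [NumberField (Kf i₂)] [IsCMField (Kf i₂)]
    {ρ : ℂ ≃+* ℂ} {π : Equiv.Perm (Fin 3) × Equiv.Perm (Fin 4)}
    (hρ₁ : ∀ a : Fin 3, (ρ : ℂ →+* ℂ).comp (e₁.symm (a, true)) = e₁.symm (π.1 a, true))
    (hρ₂ : ∀ b : Fin 4, (ρ : ℂ →+* ℂ).comp (e₂.symm (b, true)) = e₂.symm (π.2 b, true))
    (x : (j : Fin 3) × (Kf (soSlots i₀ i₁ i₂ j) →+* ℂ)) :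
    (ρ : ℂ →+* ℂ).comp x.2 ∈ (Φ x.1).1 ↔ toPtS e₁ e₂ τ x ∈ phiS π := by
  rcases sigma_cases₃ x with ⟨σ, rfl⟩ | ⟨s, rfl⟩ | ⟨t, rfl⟩
  · change (ρ : ℂ →+* ℂ).comp σ ∈ (Φ 0).1 ↔ _
    rw [hΨ, toPtS_zero, inl_mem_phiS, comp_eq_tau_iff_of_realises₃ hττ hk he₁_sign ρ hρ₁ σ]
    exact ⟨fun h => decide_eq_true h, fun h => of_decide_eq_true h⟩
  · change (ρ : ℂ →+* ℂ).comp s ∈ (Φ 1).1 ↔ _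
    rw [hΦ₁, toPtS_one, apply_comp_eq_of_realises_fin he₁_conj ρ hρ₁ s, inr_inl_mem_phiS]
  · change (ρ : ℂ →+* ℂ).comp t ∈ (Φ 2).1 ↔ _
    rw [hΦ₂, toPtS_two, apply_comp_eq_of_realises_fin he₂_conj ρ hρ₂ t, inr_inr_mem_phiS]

variable {N : ℕ} (κ : Fin N → Fin 3)

include hττ hk he₁_sign he₁_conj he₂_conj hΨ hΦ₁ hΦ₂ in
/-- **FRAME TRANSFER, no Galois hypothesis**: an `Aut(ℂ)`-balanced weight of `X = ⨁_j A(κ j)` (`IsGaloisBalancedAlg` for the CM algebra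
`∏_j K_{κ j}`, types `Φ (κ j)`) is a balanced configuration of the census model under EVERY realised pair of permutations
(`R = realisedPairs e₁ e₂`), via `v = toPtS e₁ e₂ τ ∘ P`, `P (j, s) = (κ j, s)`. [cite: GaoUllmo2025, Thm 3.1 (3.2)] [cite: Pohlmann1968, Thm 1] -/
theorem modelBalancedS_of_isGaloisBalancedAlg [NumberField (Kf i₁)] [IsCMField (Kf i₁)] [NumberField (Kf i₂)] [IsCMField (Kf i₂)]
    {S : Finset ((j : Fin N) × (Kf (soSlots i₀ i₁ i₂ (κ j)) →+* ℂ))}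
    (hS : IsGaloisBalancedAlg (K := fun j => Kf (soSlots i₀ i₁ i₂ (κ j))) (fun j => Φ (κ j)) S) :
    ModelBalancedS (realisedPairs e₁ e₂) (fun x => toPtS e₁ e₂ τ ((Sigma.map κ (fun _ => id) :
      ((j : Fin N) × (Kf (soSlots i₀ i₁ i₂ (κ j)) →+* ℂ)) → ((m : Fin 3) × (Kf (soSlots i₀ i₁ i₂ m) →+* ℂ))) x)) S := by
  intro π hπ
  beta_reduce
  obtain ⟨ρ, hρ₁, hρ₂⟩ := (mem_realisedPairs e₁ e₂ π).1 hπ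
  have h := hS ρ
  rw [ncard_sep_eq_card_filter, ncard_sep_eq_card_filter] at h
  have key : ∀ x : (j : Fin N) × (Kf (soSlots i₀ i₁ i₂ (κ j)) →+* ℂ),
      (ρ : ℂ →+* ℂ).comp x.2 ∈ (Φ (κ x.1)).1 ↔ toPtS e₁ e₂ τ ((Sigma.map κ (fun _ => id) :
        ((j : Fin N) × (Kf (soSlots i₀ i₁ i₂ (κ j)) →+* ℂ)) → ((m : Fin 3) × (Kf (soSlots i₀ i₁ i₂ m) →+* ℂ))) x) ∈ phiS π :=
    fun x => comp_mem_iff_toPtS_mem_phiS hττ hk he₁_sign he₁_conj he₂_conj hΨ hΦ₁ hΦ₂ hρ₁ hρ₂ ⟨κ x.1, x.2⟩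
  rw [Finset.filter_congr fun x _ => key x, Finset.filter_congr fun x _ => (key x).not] at h
  have htot := Finset.card_filter_add_card_filter_not
    (s := S) (fun x => toPtS e₁ e₂ τ ((Sigma.map κ (fun _ => id) :
        ((j : Fin N) × (Kf (soSlots i₀ i₁ i₂ (κ j)) →+* ℂ)) → ((m : Fin 3) × (Kf (soSlots i₀ i₁ i₂ m) →+* ℂ))) x) ∈ phiS π)
  omega

end Transfer

/-! ## §4 Conjugate pairs have algebraic (divisor) lines -/

section Pairs

variable {I : Type} {Kf : I → Type} [∀ i, Field (Kf i)] [∀ i, NumberField (Kf i)] [∀ i, IsCMField (Kf i)]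
  {i₀ i₁ i₂ : I} {N : ℕ} (κ : Fin N → Fin 3) {e₁ : (Kf i₁ →+* ℂ) ≃ Fin 3 × Bool} {e₂ : (Kf i₂ →+* ℂ) ≃ Fin 4 × Bool}
  {τ : Kf i₀ →+* ℂ} (hττ : ComplexEmbedding.conjugate τ ≠ τ) (hk : ∀ σ : Kf i₀ →+* ℂ, σ = τ ∨ σ = ComplexEmbedding.conjugate τ)
  (he₁_conj : ∀ s : Kf i₁ →+* ℂ, e₁ (ComplexEmbedding.conjugate s) = ((e₁ s).1, !(e₁ s).2))
  (he₂_conj : ∀ t : Kf i₂ →+* ℂ, e₂ (ComplexEmbedding.conjugate t) = ((e₂ t).1, !(e₂ t).2))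
  {A : Fin 3 → AbelianVariety ℂ} {Φ : ∀ j : Fin 3, CMType (Kf (soSlots i₀ i₁ i₂ j))}
  {ι : ∀ j, 𝓞 (Kf (soSlots i₀ i₁ i₂ j)) →+* End (A j)}
  {θ : ∀ j, Kf (soSlots i₀ i₁ i₂ j) →+* Module.End ℂ (complexBetti (A j).X 1)}
  (hA : ∀ j, IsCMTypeRealisation (Φ j) (A j) (ι j) (θ j))

include hττ hk he₁_conj he₂_conj hA in
/-- **A weight of `Y = ⨁ A` whose model image is a conjugate pair `{y, cjS y}` is conjugation-stable, so its line is algebraic** (a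
divisor line: Lefschetz `(1,1)` on the abelian variety `⨁ A`). [cite: Gordon1999HodgeAVSurvey, 9.2.2] -/
theorem weightClassesAlg_le_algebraicClasses_of_image_eq_pairS
    {T : Finset ((j : Fin 3) × (Kf (soSlots i₀ i₁ i₂ j) →+* ℂ))} {y : PtS} (hT : T.image (toPtS e₁ e₂ τ) = {y, cjS y}) :
    T.card = 2 ∧ weightClassesAlg A ι (2 * 1) T ≤ algebraicClasses (⨁ A).X 1 := by
  have hinj := toPtS_injective (e₁ := e₁) (e₂ := e₂) hττ hk (i₁ := i₁) (i₂ := i₂)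
  have hcard : T.card = 2 := by
    rw [← Finset.card_image_of_injective T hinj, hT]
    exact Finset.card_pair (cjS_ne y).symm
  refine ⟨hcard, weightClassesAlg_le_algebraicClasses_of_conj_smul_mem hA (m := 1) hcard fun x hx => ?_⟩
  have hx' : toPtS e₁ e₂ τ x ∈ ({y, cjS y} : Finset PtS) := hT ▸ Finset.mem_image_of_mem _ hx
  have hcx : toPtS e₁ e₂ τ ((starRingAut : ℂ ≃+* ℂ) • x) ∈ T.image (toPtS e₁ e₂ τ) := by
    rw [toPtS_conj_smul hττ hk he₁_conj he₂_conj x, hT, Finset.mem_insert, Finset.mem_singleton] at *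
    rcases hx' with h | h
    · exact Or.inr (by rw [h])
    · exact Or.inl (by rw [h, cjS_cjS])
  exact (hinj.mem_finset_image).1 hcx

include hττ hk he₁_conj he₂_conj hA in
/-- **A pair part of a weight of `X = ⨁_j A(κ j)` has an algebraic (divisor) line**: the model map is injective on it with image a
conjugate pair, so its slot projection to `Y = ⨁ A` is a weight with the same image — a divisor line — lifted along `κ` (distribution
lemma). [cite: Gordon1999HodgeAVSurvey, 9.2.2] [cite: Milne2020HodgeClassesAV, 1.2 (a) and Thm. 1] -/
theorem weightClassesAlg_le_algebraicClasses_of_isPairPartS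
    {G : Finset ((j : Fin N) × (Kf (soSlots i₀ i₁ i₂ (κ j)) →+* ℂ))}
    (hG : IsPairPartS (fun x => toPtS e₁ e₂ τ ((Sigma.map κ (fun _ => id) :
      ((j : Fin N) × (Kf (soSlots i₀ i₁ i₂ (κ j)) →+* ℂ)) → ((m : Fin 3) × (Kf (soSlots i₀ i₁ i₂ m) →+* ℂ))) x)) G) :
    G.card = 2 * 1 ∧ weightClassesAlg (fun j => A (κ j)) (fun j => ι (κ j)) (2 * 1) G ≤
      algebraicClasses (⨁ fun j => A (κ j)).X 1 := by
  obtain ⟨y, hcard, hinj, himg⟩ := hG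
  set Pm : ((j : Fin N) × (Kf (soSlots i₀ i₁ i₂ (κ j)) →+* ℂ)) → ((m : Fin 3) × (Kf (soSlots i₀ i₁ i₂ m) →+* ℂ)) :=
    Sigma.map κ (fun _ => id) with hPm
  have hPinj : Set.InjOn Pm ↑G := fun x hx x' hx' h => hinj hx hx' (by change toPtS e₁ e₂ τ (Pm x) = toPtS e₁ e₂ τ (Pm x'); rw [h])
  set TY : Finset ((m : Fin 3) × (Kf (soSlots i₀ i₁ i₂ m) →+* ℂ)) := G.image Pm with hTY
  have hTYimg : TY.image (toPtS e₁ e₂ τ) = {y, cjS y} := by rw [hTY, Finset.image_image]; exact himg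
  obtain ⟨-, hYalg⟩ := weightClassesAlg_le_algebraicClasses_of_image_eq_pairS hττ hk he₁_conj he₂_conj hA hTYimg
  have hq : G.card = 2 * 1 := by rw [hcard]
  exact ⟨hq, weightClassesAlg_comp_le_algebraicClasses_of_injOn (K := fun m => Kf (soSlots i₀ i₁ i₂ m)) hA κ hq hPinj hYalg⟩

end Pairs

end Summit.HodgeConjecture.CorCM.SexticOcticWeil

end
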